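import Summits.Ventures.DiscreteObjects.UnitDistance.MoserLocalReduction
import Mathlib.FieldTheory.IsAlgClosed.AlgebraicClosure
import Mathlib.FieldTheory.Extension
import Mathlib.Algebra.Polynomial.SpecificDegree
import Mathlib.Algebra.Polynomial.Degree.SmallDegree
import Mathlib.RingTheory.Adjoin.Polynomial.Basic
import Mathlib.Analysis.SpecialFunctions.Pow.Real

/-!
# Local data for the Moser field in an algebraic closure of `ℚ₂` (cell `pub-namedobj`, target (U), seat udg g10)

Framing (verbatim for the cell): lottery ticket; floor = certified bounds/negative ranges.

Step (A) of MOSER-FIELD.md (udg g2) in the kernel, in Galois language: in `Ω₂ = \overline{ℚ₂}` we construct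
`LocalData` (`MoserLocalReduction`): `I = √−1`, `s3 = √3`, and `ℚ₂`-automorphisms `σ : I ↦ −I` fixing `ℚ₂(s3)`
and `τ : s3 ↦ −s3` fixing `ℚ₂(I)`.  Their existence is exactly the arithmetic input "`ℚ₂(√3) ∌ i`" (the prime
over `2` of `ℚ(√3,√11)` does not split in `ℚ(√3,√11,i)`) and "`ℚ₂(i) ∌ √3`" (ramification), both reduced to
`3, −1, −3 ∉ (ℚ₂)²` (`TwoAdicSquares`).  Then the real field `ℚ(√3, √11) ⊂ ℝ` (`moserCoordField`) is embedded in
`Ω₂` by `IsAlgClosed.lift`, with image inside `ℚ₂(s3)` because `√33 ∈ ℚ₂` (`moserEmbed_mem`).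
Nothing here is literature.
-/

noncomputable section

namespace Summit.Ventures.DiscreteObjects.UnitDistance.MoserLocal

open Polynomial IntermediateField

section Generic

variable {F Ω : Type*} [Field F] [Field Ω] [Algebra F Ω]

/-- Elements of `F⟮a⟯` with `a² ∈ F` are `α + β·a` (`α, β ∈ F`). -/
theorem exists_coeffs_of_mem_adjoin_simple {a : Ω} {d : F} (ha : a ^ 2 = algebraMap F Ω d) {e : Ω}
    (he : e ∈ F⟮a⟯) : ∃ α β : F, e = algebraMap F Ω α + algebraMap F Ω β * a := by
  set q : F[X] := X ^ 2 - C d with hq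
  have hqm : q.Monic := by rw [hq]; exact monic_X_pow_sub_C d two_ne_zero
  have hqa : aeval a q = 0 := by simp [hq, ha]
  have hint : IsIntegral F a := ⟨q, hqm, by rwa [← aeval_def]⟩
  rw [← mem_toSubalgebra, adjoin_simple_toSubalgebra_of_isAlgebraic hint.isAlgebraic,
    Algebra.adjoin_singleton_eq_range_aeval] at he
  obtain ⟨p, rfl⟩ := he
  have hdeg : (p %ₘ q).degree ≤ 1 := by
    have h2 : q.degree = 2 := by rw [hq]; exact degree_X_pow_sub_C (by norm_num) d
    have := degree_modByMonic_lt p hqm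
    rw [h2] at this
    exact Order.le_of_lt_succ this
  refine ⟨(p %ₘ q).coeff 0, (p %ₘ q).coeff 1, ?_⟩
  change aeval a p = _
  rw [← aeval_modByMonic_eq_self_of_root (p := p) hqa]
  conv_lhs => rw [eq_X_add_C_of_degree_le_one hdeg]
  simp only [map_add, map_mul, aeval_C, aeval_X]
  ring

/-- Conversely `α + β·a ∈ F⟮a⟯`. -/
theorem add_mul_mem_adjoin_simple (a : Ω) (α β : F) :
    algebraMap F Ω α + algebraMap F Ω β * a ∈ F⟮a⟯ :=
  add_mem (IntermediateField.algebraMap_mem _ α)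
    (mul_mem (IntermediateField.algebraMap_mem _ β) (mem_adjoin_simple_self F a))

/-- GALOIS INPUT.  In an algebraically closed algebraic extension `Ω/F`, if `x² = c ∈ F` and NO element of the
intermediate field `E` squares to `c`, there is an `F`-automorphism of `Ω` fixing `E` pointwise and sending `x ↦ −x`
(extend `E(x) → Ω, x ↦ −x`, a root of the irreducible `X² − c ∈ E[X]`, to `Ω`; it is onto by algebraicity). -/
theorem exists_aut_neg [IsAlgClosed Ω] [Algebra.IsAlgebraic F Ω] (E : IntermediateField F Ω) {x : Ω} {c : F}
    (hx : x ^ 2 = algebraMap F Ω c) (hE : ∀ e ∈ E, e ^ 2 ≠ algebraMap F Ω c) :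
    ∃ σ : Ω ≃ₐ[F] Ω, σ x = -x ∧ ∀ e ∈ E, σ e = e := by
  set p : E[X] := X ^ 2 - C (algebraMap F E c) with hp
  have hpm : p.Monic := by rw [hp]; exact monic_X_pow_sub_C _ two_ne_zero
  have hpdeg : p.natDegree = 2 := by rw [hp]; exact natDegree_X_pow_sub_C
  have hcE : algebraMap E Ω (algebraMap F E c) = algebraMap F Ω c := (IsScalarTower.algebraMap_apply F E Ω c).symm
  have hroot : ∀ r : E, ¬ p.IsRoot r := by
    intro r hr
    rw [IsRoot.def, hp, eval_sub, eval_pow, eval_X, eval_C, sub_eq_zero] at hr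
    apply hE r r.2
    have := congrArg (algebraMap E Ω) hr
    rw [map_pow, hcE] at this
    exact this
  have hirr : Irreducible p :=
    irreducible_of_degree_le_three_of_not_isRoot (by rw [hpdeg]; decide) hroot
  have hpx : aeval x p = 0 := by
    rw [hp, map_sub, map_pow, aeval_X, aeval_C, hcE, hx, sub_self]
  have hmin : minpoly E x = p := (minpoly.eq_of_irreducible_of_monic hirr hpx hpm).symm
  have hy : aeval (-x) (minpoly E x) = 0 := by
    rw [hmin, hp, map_sub, map_pow, aeval_X, aeval_C, hcE, neg_sq, hx, sub_self]
  have hK : ∀ s : Ω, IsIntegral E s ∧ ((minpoly E s).map (algebraMap E Ω)).Splits := fun s =>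
    ⟨(Algebra.IsAlgebraic.isAlgebraic (R := F) s).isIntegral.tower_top, IsAlgClosed.splits _⟩
  obtain ⟨φ, hφ⟩ := IntermediateField.exists_algHom_of_splits_of_aeval hK hy
  have hbij : Function.Bijective φ := Algebra.IsAlgebraic.algHom_bijective φ
  let σE : Ω ≃ₐ[E] Ω := AlgEquiv.ofBijective φ hbij
  refine ⟨σE.restrictScalars F, ?_, ?_⟩
  · change φ x = -x
    exact hφ
  · intro e he
    change φ e = e
    have : φ (algebraMap E Ω ⟨e, he⟩) = algebraMap E Ω ⟨e, he⟩ := φ.commutes _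
    exact this

end Generic

/-! ## The local field side: `Ω₂ = \overline{ℚ₂}` -/

/-- An algebraic closure of `ℚ₂`. -/
abbrev Ω₂ : Type := AlgebraicClosure ℚ_[2]

/-- `Ω₂` has characteristic zero. -/
instance : CharZero Ω₂ := charZero_of_injective_algebraMap (algebraMap ℚ_[2] Ω₂).injective

/-- No element of `ℚ₂(√3) ⊂ Ω₂` squares to `−1` (i.e. `i ∉ ℚ₂(√3)`: the prime above `2` does not split in
`ℚ(√3,√11,i)/ℚ(√3,√11)`), from `−1, −3, 3 ∉ (ℚ₂)²`. -/
theorem sq_ne_neg_one_of_mem_adjoin_sqrt3 {s3 : Ω₂} (hs3 : s3 ^ 2 = 3) :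
    ∀ e ∈ ℚ_[2]⟮s3⟯, e ^ 2 ≠ algebraMap ℚ_[2] Ω₂ (-1) := by
  intro e he h
  have hs3' : s3 ^ 2 = algebraMap ℚ_[2] Ω₂ 3 := by rw [hs3, map_ofNat]
  obtain ⟨α, β, rfl⟩ := exists_coeffs_of_mem_adjoin_simple hs3' he
  rw [map_neg, map_one] at h
  -- (α + β s3)² = α² + 3β² + 2αβ s3 = -1
  have key : algebraMap ℚ_[2] Ω₂ (α ^ 2 + 3 * β ^ 2 + 1) + algebraMap ℚ_[2] Ω₂ (2 * α * β) * s3 = 0 := by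
    simp only [map_add, map_mul, map_pow, map_ofNat, map_one]
    linear_combination h - (algebraMap ℚ_[2] Ω₂ β) ^ 2 * hs3
  by_cases hab : 2 * α * β = 0
  · rw [hab, map_zero, zero_mul, add_zero, map_eq_zero] at key
    rcases mul_eq_zero.1 hab with h2a | hb
    · have ha : α = 0 := by simpa using h2a
      rw [ha] at key
      have : (3 * β) ^ 2 = -3 := by linear_combination 3 * key
      exact TwoAdic.sq_ne_neg_three (3 * β) this
    · rw [hb] at key
      have : α ^ 2 = -1 := by linear_combination key
      exact TwoAdic.sq_ne_neg_one α this
  · -- s3 ∈ ℚ₂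
    have hs3Q : s3 = algebraMap ℚ_[2] Ω₂ (-(α ^ 2 + 3 * β ^ 2 + 1) / (2 * α * β)) := by
      rw [map_div₀, map_neg, eq_div_iff ((_root_.map_ne_zero _).2 hab)]
      linear_combination key
    have : (-(α ^ 2 + 3 * β ^ 2 + 1) / (2 * α * β)) ^ 2 = 3 := by
      have h3 := hs3
      rw [hs3Q, ← map_pow] at h3
      have h3' : algebraMap ℚ_[2] Ω₂ ((-(α ^ 2 + 3 * β ^ 2 + 1) / (2 * α * β)) ^ 2) = algebraMap ℚ_[2] Ω₂ 3 := by rw [h3, map_ofNat]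
      exact (algebraMap ℚ_[2] Ω₂).injective h3'
    exact TwoAdic.sq_ne_three _ this

/-- No element of `ℚ₂(i) ⊂ Ω₂` squares to `3` (`√3 ∉ ℚ₂(i)`), from `3, −3, −1 ∉ (ℚ₂)²`. -/
theorem sq_ne_three_of_mem_adjoin_I {I : Ω₂} (hI : I ^ 2 = -1) :
    ∀ e ∈ ℚ_[2]⟮I⟯, e ^ 2 ≠ algebraMap ℚ_[2] Ω₂ 3 := by
  intro e he h
  have hI' : I ^ 2 = algebraMap ℚ_[2] Ω₂ (-1) := by rw [hI, map_neg, map_one]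
  obtain ⟨α, β, rfl⟩ := exists_coeffs_of_mem_adjoin_simple hI' he
  rw [map_ofNat] at h
  have key : algebraMap ℚ_[2] Ω₂ (α ^ 2 - β ^ 2 - 3) + algebraMap ℚ_[2] Ω₂ (2 * α * β) * I = 0 := by
    simp only [map_sub, map_mul, map_pow, map_ofNat]
    linear_combination h - (algebraMap ℚ_[2] Ω₂ β) ^ 2 * hI
  by_cases hab : 2 * α * β = 0
  · rw [hab, map_zero, zero_mul, add_zero, map_eq_zero] at key
    rcases mul_eq_zero.1 hab with h2a | hb
    · have ha : α = 0 := by simpa using h2a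
      rw [ha] at key
      have : β ^ 2 = -3 := by linear_combination -key
      exact TwoAdic.sq_ne_neg_three β this
    · rw [hb] at key
      have : α ^ 2 = 3 := by linear_combination key
      exact TwoAdic.sq_ne_three α this
  · have hIQ : I = algebraMap ℚ_[2] Ω₂ (-(α ^ 2 - β ^ 2 - 3) / (2 * α * β)) := by
      rw [map_div₀, map_neg, eq_div_iff ((_root_.map_ne_zero _).2 hab)]
      linear_combination key
    have : (-(α ^ 2 - β ^ 2 - 3) / (2 * α * β)) ^ 2 = -1 := by
      have h1 := hI
      rw [hIQ, ← map_pow] at h1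
      have h1' : algebraMap ℚ_[2] Ω₂ ((-(α ^ 2 - β ^ 2 - 3) / (2 * α * β)) ^ 2) = algebraMap ℚ_[2] Ω₂ (-1) := by rw [h1, map_neg, map_one]
      exact (algebraMap ℚ_[2] Ω₂).injective h1'
    exact TwoAdic.sq_ne_neg_one _ this

/-- THE LOCAL DATA EXIST in `Ω₂` (step (A) of MOSER-FIELD.md): `I, s3` and the automorphisms `σ, τ`. -/
theorem nonempty_localData : Nonempty (LocalData Ω₂) := by
  obtain ⟨I, hI⟩ := IsAlgClosed.exists_pow_nat_eq (-1 : Ω₂) two_pos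
  obtain ⟨s3, hs3⟩ := IsAlgClosed.exists_pow_nat_eq (3 : Ω₂) two_pos
  have hI' : I ^ 2 = algebraMap ℚ_[2] Ω₂ (-1) := by rw [hI, map_neg, map_one]
  have hs3' : s3 ^ 2 = algebraMap ℚ_[2] Ω₂ 3 := by rw [hs3, map_ofNat]
  obtain ⟨σ, hσI, hσE⟩ := exists_aut_neg ℚ_[2]⟮s3⟯ hI' (sq_ne_neg_one_of_mem_adjoin_sqrt3 hs3)
  obtain ⟨τ, hτs, hτE⟩ := exists_aut_neg ℚ_[2]⟮I⟯ hs3' (sq_ne_three_of_mem_adjoin_I hI)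
  exact ⟨⟨I, s3, hI, hs3, σ, τ, hσI, hσE s3 (mem_adjoin_simple_self _ s3), hτE I (mem_adjoin_simple_self _ I), hτs⟩⟩

/-- A fixed choice of local data in `Ω₂`. -/
def localData₂ : LocalData Ω₂ := Classical.choice nonempty_localData

/-- A fixed square root of `33` in `ℚ₂` (Hensel). -/
def sqrt33₂ : ℚ_[2] := Classical.choose TwoAdic.exists_sq_eq_thirtyThree

/-- `sqrt33₂ ^ 2 = 33`. -/
theorem sqrt33₂_sq : sqrt33₂ ^ 2 = 33 := Classical.choose_spec TwoAdic.exists_sq_eq_thirtyThree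

/-! ## The real side: the coordinate field `ℚ(√3, √11) ⊂ ℝ` and its embedding into `Ω₂` -/

/-- The real biquadratic field `ℚ(√3, √11) ⊂ ℝ` — the field generated by the coordinates of the Moser spindle
(Heule 2018 §2.1; Exoo–Ismailescu 2018 p. 8; Madore 2015 Prop. 4.5: `4 ≤ χ ≤ 5` for its plane). -/
def moserCoordField : IntermediateField ℚ ℝ := IntermediateField.adjoin ℚ {Real.sqrt 3, Real.sqrt 11}

/-- `√3 ∈ ℚ(√3, √11)`. -/
theorem sqrt3_mem : Real.sqrt 3 ∈ moserCoordField := subset_adjoin ℚ _ (by simp)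

/-- `√11 ∈ ℚ(√3, √11)`. -/
theorem sqrt11_mem : Real.sqrt 11 ∈ moserCoordField := subset_adjoin ℚ _ (by simp)

/-- Every `a + b√3 + c√11 + d√3√11` (`a b c d ∈ ℚ`) lies in `ℚ(√3, √11)`. -/
theorem combo_mem (a b c d : ℚ) :
    (a : ℝ) + b * Real.sqrt 3 + c * Real.sqrt 11 + d * (Real.sqrt 3 * Real.sqrt 11) ∈ moserCoordField := by
  have hq : ∀ q : ℚ, (q : ℝ) ∈ moserCoordField := fun q => IntermediateField.algebraMap_mem moserCoordField q
  refine add_mem (add_mem (add_mem (hq a) (mul_mem (hq b) sqrt3_mem)) (mul_mem (hq c) sqrt11_mem))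
    (mul_mem (hq d) (mul_mem sqrt3_mem sqrt11_mem))

/-- A real square root of a natural number is integral over `ℚ`. -/
theorem isIntegral_sqrt (n : ℕ) : IsIntegral ℚ (Real.sqrt n) := by
  refine ⟨X ^ 2 - C (n : ℚ), monic_X_pow_sub_C _ two_ne_zero, ?_⟩
  simp [Real.sq_sqrt (Nat.cast_nonneg n)]

/-- `ℚ(√3, √11)` is algebraic over `ℚ`. -/
instance moserCoordField_isAlgebraic : Algebra.IsAlgebraic ℚ moserCoordField := by
  apply isAlgebraic_adjoin
  intro x hx
  simp only [Set.mem_insert_iff, Set.mem_singleton_iff] at hx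
  rcases hx with rfl | rfl
  · simpa using isIntegral_sqrt 3
  · simpa using isIntegral_sqrt 11

/-- A (fixed, arbitrary) field embedding `ℚ(√3, √11) → Ω₂` over `ℚ`. -/
def moserEmbed : moserCoordField →ₐ[ℚ] Ω₂ := IsAlgClosed.lift

/-- The image of `√3` is `± s3`. -/
theorem moserEmbed_sqrt3 (D : LocalData Ω₂) :
    moserEmbed ⟨Real.sqrt 3, sqrt3_mem⟩ = D.s3 ∨ moserEmbed ⟨Real.sqrt 3, sqrt3_mem⟩ = -D.s3 := by
  have h3 : (⟨Real.sqrt 3, sqrt3_mem⟩ : moserCoordField) ^ 2 = 3 := by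
    apply Subtype.ext
    simp [Real.sq_sqrt]
    norm_cast
  have h : (moserEmbed ⟨Real.sqrt 3, sqrt3_mem⟩) ^ 2 = D.s3 ^ 2 := by
    rw [← map_pow, h3, map_ofNat, D.hs3]
  exact sq_eq_sq_iff_eq_or_eq_neg.1 h

/-- The image of `√11` is `± √33/s3` (with `√33 ∈ ℚ₂`). -/
theorem moserEmbed_sqrt11 (D : LocalData Ω₂) :
    moserEmbed ⟨Real.sqrt 11, sqrt11_mem⟩ = algebraMap ℚ_[2] Ω₂ sqrt33₂ * D.s3⁻¹ ∨
      moserEmbed ⟨Real.sqrt 11, sqrt11_mem⟩ = -(algebraMap ℚ_[2] Ω₂ sqrt33₂ * D.s3⁻¹) := by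
  have h11 : (⟨Real.sqrt 11, sqrt11_mem⟩ : moserCoordField) ^ 2 = 11 := by
    apply Subtype.ext
    simp [Real.sq_sqrt]
    norm_cast
  have hs3ne : D.s3 ≠ 0 := by
    intro h0; have := D.hs3; rw [h0] at this; norm_num at this
  have h : (moserEmbed ⟨Real.sqrt 11, sqrt11_mem⟩) ^ 2 = (algebraMap ℚ_[2] Ω₂ sqrt33₂ * D.s3⁻¹) ^ 2 := by
    rw [← map_pow, h11, map_ofNat, mul_pow, ← map_pow, sqrt33₂_sq, inv_pow, D.hs3, map_ofNat]
    norm_num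
  exact sq_eq_sq_iff_eq_or_eq_neg.1 h

/-- The structure map `ℚ → Ω₂` factors through `ℚ₂`. -/
theorem algebraMap_rat_eq (q : ℚ) : algebraMap ℚ Ω₂ q = algebraMap ℚ_[2] Ω₂ (q : ℚ_[2]) := by
  rw [map_ratCast, eq_ratCast]

/-- IMAGE LEMMA: the embedding lands in `ℚ₂(s3)` (because `√33 ∈ ℚ₂`): `moserEmbed x ∈ ℚ₂⟮s3⟯` for every `x`. -/
theorem moserEmbed_mem (D : LocalData Ω₂) (x : moserCoordField) : moserEmbed x ∈ ℚ_[2]⟮D.s3⟯ := by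
  obtain ⟨x, hx⟩ := x
  induction hx using adjoin_induction with
  | mem y hy =>
    simp only [Set.mem_insert_iff, Set.mem_singleton_iff] at hy
    rcases hy with rfl | rfl
    · rcases moserEmbed_sqrt3 D with h | h
      · rw [h]; exact mem_adjoin_simple_self _ _
      · rw [h]; exact neg_mem (mem_adjoin_simple_self _ _)
    · have hm : algebraMap ℚ_[2] Ω₂ sqrt33₂ * D.s3⁻¹ ∈ ℚ_[2]⟮D.s3⟯ :=
        mul_mem (IntermediateField.algebraMap_mem _ _) (inv_mem (mem_adjoin_simple_self _ _))
      rcases moserEmbed_sqrt11 D with h | h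
      · rw [h]; exact hm
      · rw [h]; exact neg_mem hm
  | algebraMap q =>
    have : (⟨algebraMap ℚ ℝ q, IntermediateField.algebraMap_mem _ q⟩ : moserCoordField) =
        algebraMap ℚ moserCoordField q := Subtype.ext rfl
    rw [this, moserEmbed.commutes, algebraMap_rat_eq]
    exact IntermediateField.algebraMap_mem _ _
  | add y w hy hw ihy ihw =>
    have : (⟨y + w, add_mem hy hw⟩ : moserCoordField) = ⟨y, hy⟩ + ⟨w, hw⟩ := rfl
    rw [this, map_add]; exact add_mem ihy ihw
  | inv y hy ihy =>
    have : (⟨y⁻¹, inv_mem hy⟩ : moserCoordField) = ⟨y, hy⟩⁻¹ := rfl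
    rw [this, map_inv₀]; exact inv_mem ihy
  | mul y w hy hw ihy ihw =>
    have : (⟨y * w, mul_mem hy hw⟩ : moserCoordField) = ⟨y, hy⟩ * ⟨w, hw⟩ := rfl
    rw [this, map_mul]; exact mul_mem ihy ihw

/-- Coordinates form of the image lemma: `moserEmbed x = α + β·s3` with `α, β ∈ ℚ₂`. -/
theorem exists_coeffs_moserEmbed (D : LocalData Ω₂) (x : moserCoordField) :
    ∃ α β : ℚ_[2], moserEmbed x = algebraMap ℚ_[2] Ω₂ α + algebraMap ℚ_[2] Ω₂ β * D.s3 :=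
  exists_coeffs_of_mem_adjoin_simple (d := 3) (by rw [D.hs3, map_ofNat]) (moserEmbed_mem D x)

end Summit.Ventures.DiscreteObjects.UnitDistance.MoserLocal
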